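import Mathlib.Analysis.SpecificLimits.Basic
import Summits.Ventures.CertifiedArithmetic.LowPrec.GemmThetaLawE2M3Family
import Summits.Ventures.CertifiedArithmetic.LowPrec.GemmThetaLawGenE2M3Cert
import Summits.Ventures.CertifiedArithmetic.LowPrec.GemmThetaE2M3Bound
import HarnessLib

/-!
# GEMM worst case LII — `W⁶_p(n)` for E2M3² (FP6) into EVERY precision `p ≥ 12`: the
# two-sided sandwich `θ_p/(n - 1 + θ_p(193/2 + κ_p)) ≤ 1 - W⁶_p(n) ≤ θ_p/(n - c_p)` and the
# limit `n(1 - W⁶_p(n)) → θ_p`, kernel-checked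

HONEST FRAMING: certified error envelopes and provably optimal rounding/accumulation schemes for
low-precision formats under stated cost models; every table by two implementations; no hardware or
vendor claims.

`W⁶_φ(n)` (`worstRelErrE2M3 φ (n-1)`) is the largest relative error `|ŝ - s|/Σ|x_i|` of
sequential round-to-nearest-even accumulation in the format `φ` over ALL words of `n` letters
from the 443-letter product alphabet `Π(E2M3,E2M3) = piE2M3` (a finite maximum; at
`φ = bfloat16` it is LITERALLY the landed `worstRelErrE2M3BF16` of `GemmThetaE2M3Bound`,
`worstRelErrE2M3_BFloat16`).
For every format `φ` with `11 ≤ manBits φ` (`p ≥ 12`), `qexp φ ≤ -6` and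
`2^(manBits φ + 14) ≤ maxRat φ` (binary32, binary64, …), with the law's constants
`θ_p = e2m3Law.thetaL (manBits φ) = (5·2^manBits + 8)/252`, `κ_p = 1024/(24·2^manBits + 32)`
(`e2m3Law_constants`) and `K = 2^(p-10)` (`2^manBits = 512K`, `θ_p = (640K + 2)/63`):

* `worst6P_le` (SUP side, every `n`): `W⁶_φ(n) ≤ 1 - θ_p/(n - 1 + θ_p(1 + 191/2 + κ_p))` —
  the generated law certificate `thetaCert_e2m3Law` (`GemmThetaLawGenE2M3Cert`) through
  `ThetaCertificate.abs_err_le` (`ρ = 63/2 ≤ β_pair = 191/2`);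
* `one_sub_worst6P_le` (the family of file LI, every `n ≥ 5377K + 1`):
  `1 - W⁶_φ(n) ≤ (640K + 2)/(63n - 305663K + 2) = θ_p/(n - c_p)`, `c_p = (305663K - 2)/63`;
* `worst6P_sandwich`: both at once — the E2M3 row of gemm.tex Thm. `t:thetap6` for every
  `p ≥ 12`, with onset `m_p = 5377K + 1 = 21·2^(p-2) + 2^(p-10) + 1`;
* `worst6P_tendsto`: `n·(1 - W⁶_φ(n)) → θ_p` (in `ℝ`, by the sandwich);
* `worst6P_sandwich_Binary32`: the instance `p = 24` in integers —
  `3141462892154/(18874371n + 303151166196794) ≤ 1 - W⁶_24(n) ≤ 3495254/(21n - 1669327530)`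
  for every `n ≥ 88096769` (the left side agrees with `abs_dot_err_le_e2m3_Binary32`).

What is NOT claimed: the exact value of `W⁶_p(n)` between the two sides; `p ∈ {10, 11}` (the
family of file LI is valid there, but the law certificate needs `p ≥ 12`); bfloat16 (`p = 8`,
settled separately for every `n` in `GemmThetaE2M3Bound`).  References: [Higham2002, §4.2],
[MullerEtAl2018HFPA, §6.1], [BoldoMelquiond2011Flocq]; [RouhaniEtAl2023MX, Table 1] (E2M3).
-/

namespace Summit.Ventures.CertifiedArithmetic.LowPrec.Gemm

open Literature.ComputerArithmetic.FloatingPoint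
open Literature.ComputerArithmetic.FloatingPoint.MiniFloat
open Literature.ComputerArithmetic.FloatingPoint.MiniFloat.ThetaLaw
open Literature.ComputerArithmetic.FloatingPoint.MiniFloat.ThetaE2M3 (lamG)
open Finset

/-! ### `W⁶_φ(n)` over the product alphabet, any target format -/

/-- `W⁶_φ(n)` for `n = m + 1`: the largest relative error of sequential RNE accumulation in `φ`
over all words of `n` letters from `Π(E2M3,E2M3)`. [cell, gemm.tex §Regimes] -/
def worstRelErrE2M3 (φ : Format) (m : ℕ) : ℚ :=
  (univ : Finset (Fin (m + 1) → Fin 443)).sup' univ_nonempty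
    (fun w => relErr φ (wordInputE2M3 w) m)

/-- At `bfloat16` this is literally the landed `worstRelErrE2M3BF16`. [cell, consistency] -/
theorem worstRelErrE2M3_BFloat16 (m : ℕ) :
    worstRelErrE2M3 Format.BFloat16 m = worstRelErrE2M3BF16 m := rfl

/-- Every input over the alphabet is dominated by `W⁶_φ`. [folklore] -/
theorem relErr_le_worst6P (φ : Format) (x : ℕ → ℚ) (hx : ∀ j, x j ∈ piE2M3) (m : ℕ) :
    relErr φ x m ≤ worstRelErrE2M3 φ m := by
  classical
  have hidx : ∀ j, ∃ i : Fin 443, ∀ h : i.val < piE2M3.length, piE2M3[i.val]'h = x j := by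
    intro j
    obtain ⟨i, hi, h⟩ := List.getElem_of_mem (hx j)
    exact ⟨⟨i, by simpa [piE2M3_length] using hi⟩, fun _ => h⟩
  choose f hf using hidx
  have hxy : ∀ j ≤ m, x j = wordInputE2M3 (fun j : Fin (m + 1) => f j.val) j := by
    intro j hj
    unfold wordInputE2M3
    rw [dif_pos (by omega)]
    exact (hf j _).symm
  rw [relErr_congr φ hxy]
  exact le_sup' (fun w => relErr φ (wordInputE2M3 w) m) (mem_univ _)

/-! ### The law's constants for every precision -/

/-- THE CONSTANTS OF THE E2M3² LAW AT EVERY `m = manBits`: `θ = (5·2^m + 8)/252`,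
`κ = 1024/(24·2^m + 32)`, `ρ = 63/2`, `β_pair = 191/2`. [cell, gemm.tex Thm. t:thetap6] -/
theorem e2m3Law_constants (mb : ℕ) :
    e2m3Law.thetaL mb = (5 * 2 ^ mb + 8) / 252 ∧ e2m3Law.kappaL mb = 1024 / (24 * 2 ^ mb + 32) ∧
    e2m3Law.rhoL = 63 / 2 ∧ e2m3Law.betaL = 191 / 2 := by
  have hB : e2m3Law.Bj 10 = 24 := by decide
  have hS : e2m3Law.Sj 10 = 32 := by decide
  simp only [LawData.thetaL, LawData.kappaL, LawData.rhoL, LawData.betaL,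
    show e2m3Law.kb = 10 from rfl, hB, hS, show e2m3Law.th1 = 5 from rfl,
    show e2m3Law.th0 = 8 from rfl, show e2m3Law.thD = 252 from rfl,
    show e2m3Law.rhoN = 63 from rfl, show e2m3Law.rhoD = 2 from rfl,
    show e2m3Law.betaN = 191 from rfl, show e2m3Law.betaD = 2 from rfl]
  norm_num

/-- With `K = 2^(p-10)` (`2^manBits = 512K`): `θ_p = (640K + 2)/63`. [gemm.tex Thm. t:thetap6] -/
theorem thetaL6_eq {φ : Format} {K : ℕ} (hM : 2 ^ φ.manBits = 512 * K) :
    e2m3Law.thetaL φ.manBits = (640 * (K : ℚ) + 2) / 63 := by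
  have hM' : ((2 ^ φ.manBits : ℕ) : ℚ) = ((512 * K : ℕ) : ℚ) := by rw [hM]
  push_cast at hM'
  rw [(e2m3Law_constants φ.manBits).1, hM']
  ring

/-- `θ_p > 0`. [cell] -/
theorem thetaL6_pos (mb : ℕ) : 0 < e2m3Law.thetaL mb := by
  rw [(e2m3Law_constants mb).1]; positivity

/-- `κ_p ≥ 0`. [cell] -/
theorem kappaL6_nonneg (mb : ℕ) : 0 ≤ e2m3Law.kappaL mb := by
  rw [(e2m3Law_constants mb).2.1]; positivity

/-- The product table `lamG` of `GemmThetaE2M3Defs` is contained in the law's alphabet `Λ`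
(the same 443 integers, in another order). [cell, kernel] -/
theorem lamG_subset_lam : ∀ Q ∈ lamG, Q ∈ e2m3Law.lam := by decide +kernel

/-- Letters of `Π(E2M3,E2M3)` are letters of the law. [cell] -/
theorem PiL_of_mem_piE2M3 {q : ℚ} (h : q ∈ piE2M3) : e2m3Law.PiL 6 q := by
  obtain ⟨Q, hQ, rfl⟩ := exists_of_mem_piE2M3 h
  exact ⟨Q, lamG_subset_lam Q hQ, rfl⟩

/-! ### The sandwich -/

/-- SUP SIDE FOR EVERY `p ≥ 12` AND EVERY `n = m + 1` (kernel: the generated law certificate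
`thetaCert_e2m3Law`): `W⁶_φ(n) ≤ 1 - θ_p/(m + θ_p(1 + 191/2 + κ_p))`.
[cell, gemm.tex Thm. t:thetap6] -/
theorem worst6P_le (φ : Format) (hm : 11 ≤ φ.manBits) (hq : φ.qexp ≤ -6)
    (hR : (2 : ℚ) ^ (φ.manBits + 14) ≤ φ.maxRat) (m : ℕ) :
    worstRelErrE2M3 φ m ≤ 1 - e2m3Law.thetaL φ.manBits /
      ((m : ℚ) + e2m3Law.thetaL φ.manBits * (1 + (191 / 2 + e2m3Law.kappaL φ.manBits))) := by
  have hθ := thetaL6_pos φ.manBits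
  have hκ := kappaL6_nonneg φ.manBits
  apply sup'_le
  intro w _
  unfold relErr
  have hc : (0 : ℚ) ≤ 1 - e2m3Law.thetaL φ.manBits /
      ((m : ℚ) + e2m3Law.thetaL φ.manBits * (1 + (191 / 2 + e2m3Law.kappaL φ.manBits))) := by
    rw [sub_nonneg, div_le_one (by positivity)]
    nlinarith [show (0 : ℚ) ≤ m from Nat.cast_nonneg m]
  by_cases hL : ∑ j ∈ range (m + 1), |wordInputE2M3 w j| = 0
  · rw [hL, div_zero]; exact hc
  · have hpos : 0 < ∑ j ∈ range (m + 1), |wordInputE2M3 w j| :=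
      lt_of_le_of_ne (sum_nonneg fun i _ => abs_nonneg _) (Ne.symm hL)
    rw [div_le_iff₀ hpos]
    have h := (thetaCert_e2m3Law φ hm hq hR).abs_err_le (fun q hq' => PiL_neg _ _ hq') _
      (fun j => PiL_of_mem_piE2M3 (wordInputE2M3_mem w j)) m
    rw [(e2m3Law_constants φ.manBits).2.2.1, (e2m3Law_constants φ.manBits).2.2.2,
      max_eq_right (by norm_num : (63 / 2 : ℚ) ≤ 191 / 2)] at h
    exact h

/-- THE FAMILY SIDE FOR EVERY `n = m + 1 ≥ 5377K + 1` (file LI, `K = 2^(p-10)`):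
`1 - W⁶_φ(n) ≤ (640K + 2)/(63n - 305663K + 2) = θ_p/(n - c_p)`.
[cell, gemm.tex Thm. t:thetap6] -/
theorem one_sub_worst6P_le (φ : Format) (hq : φ.qexp ≤ -6)
    (hR : (2 : ℚ) ^ (φ.manBits + 14) ≤ φ.maxRat) {K : ℕ} (hM : 2 ^ φ.manBits = 512 * K)
    (m : ℕ) (hmK : 5377 * K ≤ m) :
    1 - worstRelErrE2M3 φ m
      ≤ (640 * (K : ℚ) + 2) / (63 * ((m : ℚ) + 1) - 305663 * K + 2) := by
  have hw := relErr_le_worst6P φ (fam6 K) (fam6_mem K) m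
  have hd := fam6_defect hq hR hM m hmK
  unfold relErr at hw
  linarith

/-- THE TWO-SIDED SANDWICH FOR EVERY PRECISION `p ≥ 12` AND EVERY `n ≥ 5377·2^(p-10) + 1`
(`n = m + 1`, `K = 2^(p-10)`, `θ_p = (640K + 2)/63`, `κ_p = 1024/(24·2^manBits + 32)`):
`θ_p/(m + θ_p(1 + 191/2 + κ_p)) ≤ 1 - W⁶_p(n) ≤ θ_p/(n - (305663K - 2)/63)`, both sides
kernel-checked. [cell, gemm.tex Thm. t:thetap6] -/
theorem worst6P_sandwich (φ : Format) (hm : 11 ≤ φ.manBits) (hq : φ.qexp ≤ -6)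
    (hR : (2 : ℚ) ^ (φ.manBits + 14) ≤ φ.maxRat) {K : ℕ} (hM : 2 ^ φ.manBits = 512 * K)
    (m : ℕ) (hmK : 5377 * K ≤ m) :
    e2m3Law.thetaL φ.manBits /
        ((m : ℚ) + e2m3Law.thetaL φ.manBits * (1 + (191 / 2 + e2m3Law.kappaL φ.manBits)))
        ≤ 1 - worstRelErrE2M3 φ m ∧
      1 - worstRelErrE2M3 φ m
        ≤ e2m3Law.thetaL φ.manBits / ((m + 1 : ℚ) - (305663 * K - 2) / 63) := by
  refine ⟨by linarith [worst6P_le φ hm hq hR m], ?_⟩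
  have h := one_sub_worst6P_le φ hq hR hM m hmK
  have eB : (m + 1 : ℚ) - (305663 * K - 2) / 63
      = (63 * ((m : ℚ) + 1) - 305663 * K + 2) / 63 := by
    ring
  rw [thetaL6_eq hM, eB, div_div_div_cancel_right₀ (by norm_num : (63 : ℚ) ≠ 0)]
  exact h

/-- THE LIMIT, EVERY PRECISION `p ≥ 12`: `n · (1 - W⁶_p(n)) → θ_p` as `n → ∞` (squeezed
between the two sides of `worst6P_sandwich`). [cell, gemm.tex Thm. t:thetap6] -/
theorem worst6P_tendsto (φ : Format) (hm : 11 ≤ φ.manBits) (hq : φ.qexp ≤ -6)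
    (hR : (2 : ℚ) ^ (φ.manBits + 14) ≤ φ.maxRat) :
    Filter.Tendsto (fun m : ℕ => ((m : ℝ) + 1) * (1 - (worstRelErrE2M3 φ m : ℝ)))
      Filter.atTop (nhds (e2m3Law.thetaL φ.manBits : ℝ)) := by
  obtain ⟨K, hM⟩ : ∃ K, 2 ^ φ.manBits = 512 * K :=
    ⟨2 ^ (φ.manBits - 9), by
      rw [show (512 : ℕ) = 2 ^ 9 by norm_num, ← pow_add, Nat.add_sub_cancel' (by omega)]⟩
  set θ : ℝ := (e2m3Law.thetaL φ.manBits : ℝ) with hθdef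
  set a : ℝ := θ * (1 + (191 / 2 + (e2m3Law.kappaL φ.manBits : ℝ))) - 1 with hadef
  set b : ℝ := (305663 * (K : ℝ) - 2) / 63 with hbdef
  have hlim0 : Filter.Tendsto (fun m : ℕ => 1 / ((m : ℝ) + 1)) Filter.atTop (nhds 0) :=
    tendsto_one_div_add_atTop_nhds_zero_nat
  have hg : Filter.Tendsto (fun m : ℕ => θ / (1 + a * (1 / ((m : ℝ) + 1)))) Filter.atTop
      (nhds θ) := by
    have h : Filter.Tendsto (fun m : ℕ => θ / (1 + a * (1 / ((m : ℝ) + 1)))) Filter.atTop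
        (nhds (θ / (1 + a * 0))) :=
      tendsto_const_nhds.div (tendsto_const_nhds.add (tendsto_const_nhds.mul hlim0))
        (by norm_num)
    rw [mul_zero, add_zero, div_one] at h
    exact h
  have hh : Filter.Tendsto (fun m : ℕ => θ / (1 - b * (1 / ((m : ℝ) + 1)))) Filter.atTop
      (nhds θ) := by
    have h : Filter.Tendsto (fun m : ℕ => θ / (1 - b * (1 / ((m : ℝ) + 1)))) Filter.atTop
        (nhds (θ / (1 - b * 0))) :=
      tendsto_const_nhds.div (tendsto_const_nhds.sub (tendsto_const_nhds.mul hlim0))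
        (by norm_num)
    rw [mul_zero, sub_zero, div_one] at h
    exact h
  refine tendsto_of_tendsto_of_tendsto_of_le_of_le' hg hh ?_ ?_
  · refine Filter.eventually_atTop.2 ⟨5377 * K, fun m hmK => ?_⟩
    have hr1 := (Rat.cast_le (K := ℝ)).mpr (worst6P_sandwich φ hm hq hR hM m hmK).1
    push_cast at hr1
    have hm0 : (0 : ℝ) < (m : ℝ) + 1 := by positivity
    have hm1 : (m : ℝ) + 1 ≠ 0 := hm0.ne'
    have e1 : 1 + a * (1 / ((m : ℝ) + 1)) = (((m : ℝ) + 1) + a) / ((m : ℝ) + 1) := by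
      rw [eq_div_iff hm1, add_mul, one_mul, mul_assoc, one_div_mul_cancel hm1, mul_one]
    have e2 : ((m : ℝ) + 1) + a
        = (m : ℝ) + θ * (1 + (191 / 2 + (e2m3Law.kappaL φ.manBits : ℝ))) := by
      rw [hadef]; ring
    show θ / (1 + a * (1 / ((m : ℝ) + 1))) ≤ ((m : ℝ) + 1) * (1 - (worstRelErrE2M3 φ m : ℝ))
    rw [e1, div_div_eq_mul_div, e2]
    calc θ * ((m : ℝ) + 1) / ((m : ℝ) + θ * (1 + (191 / 2 + (e2m3Law.kappaL φ.manBits : ℝ))))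
        = ((m : ℝ) + 1) *
            (θ / ((m : ℝ) + θ * (1 + (191 / 2 + (e2m3Law.kappaL φ.manBits : ℝ))))) := by ring
      _ ≤ ((m : ℝ) + 1) * (1 - (worstRelErrE2M3 φ m : ℝ)) :=
          mul_le_mul_of_nonneg_left hr1 hm0.le
  · refine Filter.eventually_atTop.2 ⟨5377 * K, fun m hmK => ?_⟩
    have hr2 := (Rat.cast_le (K := ℝ)).mpr (worst6P_sandwich φ hm hq hR hM m hmK).2
    push_cast at hr2
    have hm0 : (0 : ℝ) < (m : ℝ) + 1 := by positivity
    have hm1 : (m : ℝ) + 1 ≠ 0 := hm0.ne'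
    have e1 : 1 - b * (1 / ((m : ℝ) + 1)) = (((m : ℝ) + 1) - b) / ((m : ℝ) + 1) := by
      rw [eq_div_iff hm1, sub_mul, one_mul, mul_assoc, one_div_mul_cancel hm1, mul_one]
    show ((m : ℝ) + 1) * (1 - (worstRelErrE2M3 φ m : ℝ))
      ≤ θ / (1 - b * (1 / ((m : ℝ) + 1)))
    rw [e1, div_div_eq_mul_div, hbdef]
    calc ((m : ℝ) + 1) * (1 - (worstRelErrE2M3 φ m : ℝ))
        ≤ ((m : ℝ) + 1) * (θ / (((m : ℝ) + 1) - (305663 * (K : ℝ) - 2) / 63)) :=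
          mul_le_mul_of_nonneg_left hr2 hm0.le
      _ = θ * ((m : ℝ) + 1) / (((m : ℝ) + 1) - (305663 * (K : ℝ) - 2) / 63) := by ring

/-! ### The instance `p = 24` (binary32) in integers -/

/-- binary32 meets the hypotheses, with `K = 2^14 = 16384`. [cite: IEEE7542019, Table 3.5] -/
theorem Binary32_hyps6 : 11 ≤ Format.Binary32.manBits ∧ Format.Binary32.qexp ≤ -6 ∧
    (2 : ℚ) ^ (Format.Binary32.manBits + 14) ≤ Format.Binary32.maxRat ∧
    2 ^ Format.Binary32.manBits = 512 * 16384 := by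
  obtain ⟨h1, h2, h3⟩ := Binary32_hyps_e2m3
  exact ⟨by rw [h1]; norm_num, h2, h3, by rw [h1]; norm_num⟩

/-- E2M3² INTO binary32, EVERY `n ≥ 88096769 = 5377·2^14 + 1`:
`3141462892154/(18874371n + 303151166196794) ≤ 1 - W⁶_24(n) ≤ 3495254/(21n - 1669327530)`;
the left side holds for every `n` (the law's envelope `abs_dot_err_le_e2m3_Binary32`), the right
side is the family; `θ_24 = 499322/3` and `n(1 - W⁶_24(n)) → θ_24`.
[cell, gemm.tex Thm. t:thetap6 at p = 24] -/
theorem worst6P_sandwich_Binary32 (m : ℕ) (hm : 88096768 ≤ m) :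
    3141462892154 / (18874371 * ((m : ℚ) + 1) + 303151166196794)
        ≤ 1 - worstRelErrE2M3 Format.Binary32 m ∧
      1 - worstRelErrE2M3 Format.Binary32 m ≤ 3495254 / (21 * ((m : ℚ) + 1) - 1669327530) := by
  obtain ⟨h1, h2, h3, h4⟩ := Binary32_hyps6
  have h := worst6P_sandwich Format.Binary32 h1 h2 h3 h4 m (by omega)
  rw [Binary32_hyps_e2m3.1, lawConstants_e2m3_Binary32.1,
    lawConstants_e2m3_Binary32.2.1] at h
  have hm' : (88096768 : ℚ) ≤ m := by exact_mod_cast hm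
  have e1 : (499322 / 3 : ℚ) / ((m : ℚ) + 499322 / 3 * (1 + (191 / 2 + 32 / 6291457)))
      = 3141462892154 / (18874371 * ((m : ℚ) + 1) + 303151166196794) := by
    rw [div_eq_div_iff (by positivity) (by positivity)]; ring
  have e2 : (499322 / 3 : ℚ) / ((m + 1 : ℚ) - (305663 * ((16384 : ℕ) : ℚ) - 2) / 63)
      = 3495254 / (21 * ((m : ℚ) + 1) - 1669327530) := by
    rw [div_eq_div_iff (ne_of_gt (by push_cast; linarith)) (ne_of_gt (by linarith))]
    push_cast; ring
  rw [e1, e2] at h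
  exact h

end Summit.Ventures.CertifiedArithmetic.LowPrec.Gemm
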